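import Literature.NumberTheory.LFunctions.LargeValueBoundGuthMaynard
import Literature.NumberTheory.LFunctions.ZeroDensityThirtyThirteenths
import HarnessLib

/-!
# A gain in the third term of Guth–Maynard's large values theorem lowers the uniform exponent `30/13`

LABEL (line 1): **NOT RH-BEARING** — bookkeeping of zero-density EXPONENTS for `ζ` from large value
bounds for Dirichlet polynomials; a density COUNT never empties the strip
(`Literature.Barriers.RiemannHypothesis.LindelofBacklund`). RH-FREE literature tooling. The large
values HYPOTHESIS of this file (a `δ`-gain in Guth–Maynard's third term) is OPEN, is a hypothesis
BINDER of every theorem below (never a definition, never a named fact), and is nobody's target here.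
Nothing in this file improves `30/13`, and nothing here bears on the truth of RH.

Topic `NumberTheory/LFunctions`, family RH; bears on the LADDER-RH §4 HELD row `DensityLadder`
(`Summits/RiemannHypothesis/RiemannHypothesis/Theses/DensityLadder.lean`), crux X1
`BeatThirtyThirteenths` (`∃ A < 30/13, ZeroDensityEstimate (fun _ ↦ A) (1/2)`), whose two-layer plan
reads "`BeatThirtyThirteenths ⇐ LargeValuesThirdTermGain δ` (`∃ δ > 0`; GM Thm 1.1 with
`T·N^{12/5−δ}·V⁻⁴`) `→ WindowDetectionParam` (S1, the parametrised §13.1) `→ BeatThirtyThirteenths`".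
This file PROVES the step S1 and the glue in the exponent language `LV(σ,τ) ≤ ρ`
(`LargeValueBound`, Tao–Trudgian–Yang 2025 Definition 27): the ONLY input left is the `δ`-gain
itself, an explicit hypothesis. A leaf (imports the Guth–Maynard chain through
`LargeValueBoundGuthMaynard.lean` and `ZeroDensityThirtyThirteenths.lean`).

## The printed remark being formalised

L. Guth, J. Maynard, *New large value estimates for Dirichlet polynomials*, Ann. of Math. (2) 203
(2026) = arXiv:2405.20552, §13.1, Remark after the proof of Theorem 1.2 (p. 28 of the arXiv
version): "For the purposes of proving a zero density estimate of the form
`N(σ,T) ≲ T^{A(1−σ)}` with `A` a fixed constant as small as possible, the critical case in our work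
is when `σ = 7/10`, `N = T^{5/13}` (so we apply Theorem 1.1 to a Dirichlet polynomial of length
`N² = T^{10/13}`) … In this critical situation our bounds for `S₁` and `S₂` are both best possible,
and so any further improvement would have to come from the `S₃` term." In the exponent language
(Tao–Trudgian–Yang, the display before Theorem 32: "`LV(σ,τ) ≤ max(2−2σ, 18/5−4σ, τ+12/5−4σ)`")
the `S₃` term is the third entry `τ + 12/5 − 4σ`, and the critical case is `(σ, τ) = (7/10, 13/10)`
(`N² = T^{10/13}`, i.e. `T = (N²)^{13/10}`).

The ARCHITECTURE is the printed proof of Tao–Trudgian–Yang's Theorem 49 ("Guth–Maynard bound. For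
any `1/2 < σ < 1`, one has `A(σ) ≤ 15/(3+5σ)`. Proof. We may assume that `7/10 < σ < 8/10`, since the
bound follows from the Ingham and Huxley bounds otherwise. We apply Corollary 43 with
`τ₀ := (3+5σ)/5`. We have `4τ₀/3 < 2`, so the claim (lvoz) is vacuous and we only need to establish
(lvo). We split into the subranges … In the former range we use (guth-maynard-lvt) … the third
inequality is actually an equality when `τ = τ₀` …", arXiv p. 18), run with the SHIFTED parameter
`τ₀ := (3 + 5σ + 5d)/5` that a gain `δ ≥ d` in the third term permits (the third inequality is again
an equality at `τ = τ₀` when `d = δ`): below a threshold in `τ` the mean value theorem (TTY Theorem 31)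
suffices, above it the `δ`-improved Guth–Maynard row; the split point used here is
`τ(4σ − 12/5 + d) = (2σ − 1)τ₀` (where the mean value row stops working) rather than TTY's
`13/5 − 2σ`.

## What this file proves (theorems only; no definition, no named fact)

Write `GMδ(σ,τ) := max(2−2σ, 18/5−4σ, τ+12/5−δ−4σ)` (Guth–Maynard's row with a gain `δ` in the third
term) and `τ₀(σ) := 3/5 + σ + d` for a parameter `0 < d ≤ min(δ, 1/100)`.

* `ThirdTermGain.meanValue_terms_le`, `ThirdTermGain.gain_terms_le` — the affine case analysis on
  the box `69/100 ≤ σ ≤ 71/100`, `1 ≤ τ ≤ τ₀(σ)`: for `τ(4σ−12/5+d) ≤ (2σ−1)τ₀` the mean value row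
  `max(2−2σ, 1+τ−2σ)` is `≤ (3−3σ)τ/τ₀`, and for `τ(4σ−12/5+d) ≥ (2σ−1)τ₀` the row `GMδ(σ,τ)` is
  (the second entry needs `3(1−σ)(2σ−1) ≥ (18/5−4σ)(4σ−12/5+d)`, which holds on the box with room
  `≥ 1/50`; at `(σ, d) = (7/10, 0)` the two thresholds are `τ/τ₀ = 8/9 < 1`).
* `ThirdTermGain.largeValueBound_target` — hence `LV(σ,τ) ≤ (3−3σ)τ/τ₀(σ)` for `1 ≤ τ ≤ τ₀(σ)` on
  the box, from the mean value row (`largeValueBound_meanValue`, TTY Theorem 31, a tree theorem) and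
  the hypothesis `LargeValueBound σ τ (GMδ(σ,τ))`.
* `isBigO_zetaZeroCountRe_of_thirdTermGain` — **S1**: on the box, `N(σ,T) ≪_ε T^{15(1−σ)/(3+5σ+5d)+ε}`
  (`= 3/τ₀(σ)`), by the tree's zero detection in `LV`-language
  `isBigO_zetaZeroCountRe_of_largeValueBound` (TTY Corollary 43 with `1 ≤ τ₀ ≤ 3/2`, the
  `ζ`-condition vacuous). At `d = 0` this is Guth–Maynard's `15/(3+5σ)`.
* `zeroDensityEstimate_of_thirdTermGain` — **the uniform exponent**: `N(σ,T) ≪_ε T^{A(1−σ)+ε}` for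
  every `1/2 ≤ σ ≤ 1` with `A = 30/(13+5d) < 30/13`, combining S1 on `[7/10 − d/2, 71/100]` with the
  tree THEOREMS `zeroDensity_ingham_holds` (Ingham, `3/(2−σ) ≤ 30/(13+5d)` iff `σ ≤ 7/10 − d/2`) and
  `zeroDensity_guth_maynard_holds` (Guth–Maynard Thm 1.2, `15/(3+5σ) ≤ 30/(13+5d)` for `σ ≥ 71/100`).
* `exists_zeroDensityEstimate_lt_thirty_thirteenths_of_thirdTermGain` — **X1 from the `δ`-gain**:
  `∃ A < 30/13, ZeroDensityEstimate (fun _ ↦ A) (1/2)` (verbatim the body of the crux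
  `BeatThirtyThirteenths`) from `LargeValueBound σ τ (GMδ(σ,τ))` on the box `69/100 ≤ σ ≤ 71/100`,
  `1 ≤ τ ≤ 3/2` ALONE; `…_of_thirdTermGain'` — the same from the hypothesis for all `σ` and all
  `τ > 0` (the shape of `largeValueBound_guthMaynard`).
* `largeValueBound_of_thirdTermGain_finitary`, `exists_zeroDensityEstimate_lt_thirty_thirteenths_of_finitary`
  — the same from the FINITARY shape of Guth–Maynard's Theorem 1.1 with third term `T·N^{12/5−δ}·V⁻⁴`
  (the tree's `GuthMaynard2026_theorem_1_1` with `12/5` replaced by `12/5 − δ`), by the bookkeeping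
  of `largeValueBound_guthMaynard`.

The one-line reason: Ingham's exponent `3/(2−σ)` (increasing) and Guth–Maynard's `15/(3+5σ)`
(decreasing) cross ONLY at `σ = 7/10`, where both equal `30/13`; a third-term gain `δ` on a window
around `7/10` replaces `15/(3+5σ)` by `15/(3+5σ+5d)` there (`d = δ′ := min(δ, 1/100)`), which moves
the crossing to `σ = 7/10 − d/2` and the uniform exponent to `max = 30/(13+5d) < 30/13`. The window
constant is `c = 1/100` (the box `69/100 ≤ σ ≤ 71/100`), the `τ`-range `1 ≤ τ ≤ 3/2`
(`N ≤ T ≤ N^{3/2}`). So, in the kernel: ANY gain `δ > 0` in the third term of Guth–Maynard's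
Theorem 1.1 — and already a gain valid only on that box — gives a uniform zero-density exponent
`30/(13 + 5·min(δ, 1/100)) < 30/13`; the mean value theorem (Ingham's input) and the landed theorems
at both ends supply everything else. WHAT THIS IS NOT: the gain is not proved, not
conjectured here, and not claimed to be in reach (Guth–Maynard, same Remark: "Our bound for `E(W)`
is also likely to be difficult to improve … The argument of Section 9 is also essentially tight if
…"); the implication is RH-free exponent bookkeeping.

## References

* L. Guth, J. Maynard, Ann. of Math. (2) 203 (2026) 623–675 = arXiv:2405.20552: Theorem 1.1,
  Theorem 1.2, §13.1 and the Remark closing it (arXiv p. 28). [key `GuthMaynard2026`]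
* T. Tao, T. Trudgian, A. Yang, *New exponent pairs, zero density estimates, and zero additive energy
  estimates: a systematic approach*, arXiv:2501.16779 (2025): Definition 27, Theorem 31, the display
  (guth-maynard-lvt) before Theorem 32, Corollary 43, Theorem 49 (Guth–Maynard bound) and its proof
  (arXiv p. 18). [key `TaoTrudgianYang2025`]
* A. E. Ingham, *On the estimation of `N(σ,T)`*, Quart. J. Math. Oxford 11 (1940) 291–292 (the tree's
  `zeroDensity_ingham_holds`).
-/

noncomputable section

open Real Set Filter Topology Complex MeasureTheory Finset Asymptotics

namespace Literature.NumberTheory.LFunctions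

namespace ThirdTermGain

/-! ## The affine case analysis on the box `69/100 ≤ σ ≤ 71/100` -/

/-- The first entry: `2 − 2σ ≤ (3−3σ)τ/τ₀` for `τ ≥ 1`, `τ₀ = 3/5 + σ + d ≤ 3/2` (i.e. `τ ≥ 2τ₀/3`).
Private plumbing. [folklore] -/
private theorem first_term_le {σ d τ : ℝ} (hσ₁ : 69 / 100 ≤ σ) (hσ₂ : σ ≤ 71 / 100) (hd0 : 0 ≤ d)
    (hd1 : d ≤ 1 / 100) (hτ1 : 1 ≤ τ) :
    2 - 2 * σ ≤ τ * (3 - 3 * σ) / (3 / 5 + σ + d) := by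
  have hτ₀ : 0 < 3 / 5 + σ + d := by linarith
  rw [le_div_iff₀ hτ₀]
  have h1 : (2 - 2 * σ) * (3 / 5 + σ + d) ≤ (2 - 2 * σ) * (3 / 2) :=
    mul_le_mul_of_nonneg_left (by linarith) (by linarith)
  have h2 : (3 - 3 * σ) * 1 ≤ (3 - 3 * σ) * τ := mul_le_mul_of_nonneg_left hτ1 (by linarith)
  linarith

/-- **The mean value row suffices below the threshold**: if `τ(4σ − 12/5 + d) ≤ (2σ − 1)τ₀`
(`τ₀ = 3/5 + σ + d`), then `max(2 − 2σ, 1 + τ − 2σ) ≤ (3 − 3σ)τ/τ₀` — indeed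
`(1 + τ − 2σ)τ₀ = τ(4σ − 12/5 + d) − (2σ − 1)τ₀ + τ(3 − 3σ)`. (Tao–Trudgian–Yang Theorem 31 is the
row; at `d = 0` and `τ = τ₀ = 13/10`, `σ = 7/10` this is Ingham's exponent `3/(2−σ) = 30/13`.)
[cite: TaoTrudgianYang2025, Theorem 31 and Corollary 43] -/
theorem meanValue_terms_le {σ d τ : ℝ} (hσ₁ : 69 / 100 ≤ σ) (hσ₂ : σ ≤ 71 / 100) (hd0 : 0 ≤ d)
    (hd1 : d ≤ 1 / 100) (hτ1 : 1 ≤ τ)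
    (hcase : τ * (4 * σ - 12 / 5 + d) ≤ (2 * σ - 1) * (3 / 5 + σ + d)) :
    max (2 - 2 * σ) (1 + τ - 2 * σ) ≤ τ * (3 - 3 * σ) / (3 / 5 + σ + d) := by
  refine max_le (first_term_le hσ₁ hσ₂ hd0 hd1 hτ1) ?_
  have hτ₀ : 0 < 3 / 5 + σ + d := by linarith
  rw [le_div_iff₀ hτ₀]
  have key : (1 + τ - 2 * σ) * (3 / 5 + σ + d) =
      τ * (4 * σ - 12 / 5 + d) - (2 * σ - 1) * (3 / 5 + σ + d) + τ * (3 - 3 * σ) := by ring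
  rw [key]
  linarith

/-- **The `δ`-improved Guth–Maynard row suffices above the threshold**: if
`(2σ − 1)τ₀ ≤ τ(4σ − 12/5 + d)`, `1 ≤ τ ≤ τ₀ = 3/5 + σ + d`, `0 ≤ d ≤ min(δ, 1/100)` and
`69/100 ≤ σ ≤ 71/100`, then `max(2 − 2σ, 18/5 − 4σ, τ + 12/5 − δ − 4σ) ≤ (3 − 3σ)τ/τ₀`. The second
entry uses `3(1 − σ)(2σ − 1) ≥ (18/5 − 4σ)(4σ − 12/5 + d)`, i.e.
`10(σ − 3/4)² + 3/200 ≥ d(18/5 − 4σ)`, true on the box; the third uses `τ ≤ τ₀` and `d ≤ δ`.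
[cite: GuthMaynard2026, Section 13.1, Remark after the proof of Theorem 1.2] [cite: TaoTrudgianYang2025, display (guth-maynard-lvt) before Theorem 32 and Corollary 43] -/
theorem gain_terms_le {σ δ d τ : ℝ} (hσ₁ : 69 / 100 ≤ σ) (hσ₂ : σ ≤ 71 / 100) (hd0 : 0 ≤ d)
    (hd1 : d ≤ 1 / 100) (hdδ : d ≤ δ) (hτ1 : 1 ≤ τ) (hτ2 : τ ≤ 3 / 5 + σ + d)
    (hcase : (2 * σ - 1) * (3 / 5 + σ + d) ≤ τ * (4 * σ - 12 / 5 + d)) :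
    max (2 - 2 * σ) (max (18 / 5 - 4 * σ) (τ + 12 / 5 - δ - 4 * σ)) ≤
      τ * (3 - 3 * σ) / (3 / 5 + σ + d) := by
  have hτ₀ : 0 < 3 / 5 + σ + d := by linarith
  have hm : 0 < 4 * σ - 12 / 5 + d := by linarith
  refine max_le (first_term_le hσ₁ hσ₂ hd0 hd1 hτ1) (max_le ?_ ?_)
  · -- the second entry `18/5 − 4σ`
    rw [le_div_iff₀ hτ₀]
    have hf : (18 / 5 - 4 * σ) * (4 * σ - 12 / 5 + d) ≤ 3 * (1 - σ) * (2 * σ - 1) := by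
      have hA : 0 ≤ 18 / 5 - 4 * σ := by linarith
      have hB : d * (18 / 5 - 4 * σ) ≤ 1 / 100 * (18 / 5 - 4 * σ) :=
        mul_le_mul_of_nonneg_right hd1 hA
      nlinarith [sq_nonneg (σ - 3 / 4)]
    have h3 : (18 / 5 - 4 * σ) * (3 / 5 + σ + d) * (4 * σ - 12 / 5 + d) ≤
        3 * (1 - σ) * τ * (4 * σ - 12 / 5 + d) := by
      calc (18 / 5 - 4 * σ) * (3 / 5 + σ + d) * (4 * σ - 12 / 5 + d)
          = (18 / 5 - 4 * σ) * (4 * σ - 12 / 5 + d) * (3 / 5 + σ + d) := by ring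
        _ ≤ 3 * (1 - σ) * (2 * σ - 1) * (3 / 5 + σ + d) :=
            mul_le_mul_of_nonneg_right hf hτ₀.le
        _ = 3 * (1 - σ) * ((2 * σ - 1) * (3 / 5 + σ + d)) := by ring
        _ ≤ 3 * (1 - σ) * (τ * (4 * σ - 12 / 5 + d)) :=
            mul_le_mul_of_nonneg_left hcase (by linarith)
        _ = 3 * (1 - σ) * τ * (4 * σ - 12 / 5 + d) := by ring
    have h4 : (18 / 5 - 4 * σ) * (3 / 5 + σ + d) ≤ 3 * (1 - σ) * τ :=
      le_of_mul_le_mul_right h3 hm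
    linarith
  · -- the third entry `τ + 12/5 − δ − 4σ`
    rw [le_div_iff₀ hτ₀]
    have key : (τ + 12 / 5 - δ - 4 * σ) * (3 / 5 + σ + d) =
        τ * (3 - 3 * σ) + (τ * (4 * σ - 12 / 5 + d) - (4 * σ - 12 / 5 + δ) * (3 / 5 + σ + d)) := by
      ring
    have h1 : τ * (4 * σ - 12 / 5 + d) ≤ (3 / 5 + σ + d) * (4 * σ - 12 / 5 + d) :=
      mul_le_mul_of_nonneg_right hτ2 hm.le
    have h2 : (3 / 5 + σ + d) * (4 * σ - 12 / 5 + d) ≤ (3 / 5 + σ + d) * (4 * σ - 12 / 5 + δ) :=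
      mul_le_mul_of_nonneg_left (by linarith) hτ₀.le
    rw [key]
    nlinarith

/-- **`LV(σ,τ) ≤ (3 − 3σ)τ/τ₀(σ)` on `1 ≤ τ ≤ τ₀(σ) = 3/5 + σ + d`** for `69/100 ≤ σ ≤ 71/100`,
`0 < d ≤ min(δ, 1/100)`, from the mean value row (the tree theorem `largeValueBound_meanValue`) and
the `δ`-improved Guth–Maynard row as a HYPOTHESIS — the hypothesis of Tao–Trudgian–Yang's
Corollary 43 at this `τ₀` (the two-range split of their proof of Theorem 49, at the shifted `τ₀`).
[cite: TaoTrudgianYang2025, Theorem 31, Corollary 43 and the proof of Theorem 49] [cite: GuthMaynard2026, Section 13.1, Remark after the proof of Theorem 1.2] -/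
theorem largeValueBound_target {σ δ d τ : ℝ} (hσ₁ : 69 / 100 ≤ σ) (hσ₂ : σ ≤ 71 / 100)
    (hd0 : 0 ≤ d) (hd1 : d ≤ 1 / 100) (hdδ : d ≤ δ) (hτ1 : 1 ≤ τ) (hτ2 : τ ≤ 3 / 5 + σ + d)
    (hLV : LargeValueBound σ τ (max (2 - 2 * σ) (max (18 / 5 - 4 * σ) (τ + 12 / 5 - δ - 4 * σ)))) :
    LargeValueBound σ τ (τ * (3 - 3 * σ) / (3 / 5 + σ + d)) := by
  rcases le_total (τ * (4 * σ - 12 / 5 + d)) ((2 * σ - 1) * (3 / 5 + σ + d)) with h | h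
  · exact (largeValueBound_meanValue (by linarith)).mono (meanValue_terms_le hσ₁ hσ₂ hd0 hd1 hτ1 h)
  · exact hLV.mono (gain_terms_le hσ₁ hσ₂ hd0 hd1 hdδ hτ1 hτ2 h)

end ThirdTermGain

open ThirdTermGain

/-! ## S1: the density exponent `15/(3 + 5σ + 5d)` near `σ = 7/10` -/

/-- **S1 — the parametrised Guth–Maynard window in `LV`-language.** Let `69/100 ≤ σ ≤ 71/100`,
`0 < d ≤ 1/100`, `d ≤ δ`, and suppose the `δ`-improved Guth–Maynard row
`LV(σ,τ) ≤ max(2−2σ, 18/5−4σ, τ+12/5−δ−4σ)` for `1 ≤ τ ≤ 3/2` (finitary form `LargeValueBound`).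
Then `N(σ,T) ≪_ε T^{15(1−σ)/(3+5σ+5d)+ε}` for every `ε > 0` — zero detection at
`τ₀ = 3/5 + σ + d ∈ [1, 3/2]` (the tree's `isBigO_zetaZeroCountRe_of_largeValueBound`, Tao–Trudgian–Yang
Corollary 43 with the `ζ`-condition vacuous: `A(σ) ≤ 3/τ₀`) fed by
`ThirdTermGain.largeValueBound_target`. At `d = 0` the exponent is Guth–Maynard's `15/(3+5σ)`
(Theorem 1.2, in the `LV`-language proof of Tao–Trudgian–Yang's Theorem 49: "We apply Corollary 43
with `τ₀ := (3+5σ)/5`"); the gain `δ` in the third term moves `τ₀` from `3/5 + σ` to `3/5 + σ + d`.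
[cite: GuthMaynard2026, Section 13.1, Remark after the proof of Theorem 1.2] [cite: TaoTrudgianYang2025, Corollary 43 and the proof of Theorem 49] -/
theorem isBigO_zetaZeroCountRe_of_thirdTermGain {σ δ d : ℝ} (hσ₁ : 69 / 100 ≤ σ)
    (hσ₂ : σ ≤ 71 / 100) (hd0 : 0 < d) (hd1 : d ≤ 1 / 100) (hdδ : d ≤ δ)
    (hLV : ∀ τ : ℝ, 1 ≤ τ → τ ≤ 3 / 2 →
      LargeValueBound σ τ (max (2 - 2 * σ) (max (18 / 5 - 4 * σ) (τ + 12 / 5 - δ - 4 * σ)))) :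
    ∀ ε > 0, (fun T : ℝ ↦ (zetaZeroCountRe σ T : ℝ)) =O[atTop]
      fun T : ℝ ↦ T ^ (15 / (3 + 5 * σ + 5 * d) * (1 - σ) + ε) := by
  have hτ₀1 : (1 : ℝ) ≤ 3 / 5 + σ + d := by linarith
  have hτ₀2 : 3 / 5 + σ + d ≤ 3 / 2 := by linarith
  have h := isBigO_zetaZeroCountRe_of_largeValueBound (σ := σ) (τ₀ := 3 / 5 + σ + d)
    (by linarith) (by linarith) hτ₀1 hτ₀2
    (fun τ hτ1 hτ2 ↦ largeValueBound_target hσ₁ hσ₂ hd0.le hd1 hdδ hτ1 hτ2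
      (hLV τ hτ1 (hτ2.trans hτ₀2)))
  have e : 3 / (3 / 5 + σ + d) = 15 / (3 + 5 * σ + 5 * d) := by
    rw [div_eq_div_iff (by linarith) (by linarith)]; ring
  intro ε hε
  refine (h ε hε).trans (isBigO_rpow_rpow_atTop_of_le (le_of_eq ?_))
  rw [e]

/-! ## The uniform exponent `30/(13 + 5d) < 30/13` -/

/-- **A uniform zero-density exponent below `30/13` from a gain in Guth–Maynard's third term.**
Let `0 < d ≤ 1/100`, `d ≤ δ`, and suppose `LV(σ,τ) ≤ max(2−2σ, 18/5−4σ, τ+12/5−δ−4σ)`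
(`LargeValueBound`) for all `69/100 ≤ σ ≤ 71/100` and `1 ≤ τ ≤ 3/2`. Then
`N(σ,T) ≪_ε T^{A(1−σ)+ε}` for every `1/2 ≤ σ ≤ 1` with `A = 30/(13 + 5d)`: on `[1/2, 7/10 − d/2]`
by Ingham's theorem (tree: `zeroDensity_ingham_holds`; `3/(2−σ) ≤ 30/(13+5d) ⟺ σ ≤ 7/10 − d/2`),
on `[7/10 − d/2, 71/100]` by `isBigO_zetaZeroCountRe_of_thirdTermGain`
(`15/(3+5σ+5d) ≤ 30/(13+5d) ⟺ σ ≥ 7/10 − d/2`), on `[71/100, 1]` by Guth–Maynard's Theorem 1.2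
(tree: `zeroDensity_guth_maynard_holds`; `15/(3+5σ) ≤ 300/131 ≤ 30/(13+5d)`). This is the
assembly "Ingham below `7/10`, Theorem 1.2 above" of Guth–Maynard §1 run with the improved window.
[cite: GuthMaynard2026, Theorem 1.2 and the display following it; Section 13.1, Remark after the proof of Theorem 1.2] -/
theorem zeroDensityEstimate_of_thirdTermGain {δ d : ℝ} (hd0 : 0 < d) (hd1 : d ≤ 1 / 100)
    (hdδ : d ≤ δ)
    (hLV : ∀ σ τ : ℝ, 69 / 100 ≤ σ → σ ≤ 71 / 100 → 1 ≤ τ → τ ≤ 3 / 2 →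
      LargeValueBound σ τ (max (2 - 2 * σ) (max (18 / 5 - 4 * σ) (τ + 12 / 5 - δ - 4 * σ)))) :
    ZeroDensityEstimate (fun _ ↦ 30 / (13 + 5 * d)) (1 / 2) := by
  intro ε hε σ h₀ h₁
  have hD : (0 : ℝ) < 13 + 5 * d := by linarith
  rcases le_total σ (7 / 10 - d / 2) with hσ | hσ
  · -- Ingham on `[1/2, 7/10 − d/2]`
    refine zeroDensity_ingham_holds.isBigO_of_le hε h₀ h₁ ?_
    show 3 / (2 - σ) ≤ 30 / (13 + 5 * d)
    rw [div_le_div_iff₀ (by linarith) hD]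
    nlinarith
  rcases le_total σ (71 / 100) with hσ' | hσ'
  · -- the improved window on `[7/10 − d/2, 71/100]`
    refine (isBigO_zetaZeroCountRe_of_thirdTermGain (by linarith) hσ' hd0 hd1 hdδ
      (fun τ hτ1 hτ2 ↦ hLV σ τ (by linarith) hσ' hτ1 hτ2) ε hε).trans
      (isBigO_rpow_rpow_atTop_of_le ?_)
    have hle : 15 / (3 + 5 * σ + 5 * d) ≤ 30 / (13 + 5 * d) := by
      rw [div_le_div_iff₀ (by linarith) hD]
      nlinarith
    have := mul_le_mul_of_nonneg_right hle (sub_nonneg.mpr h₁)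
    linarith
  · -- Guth–Maynard on `[71/100, 1]`
    refine zeroDensity_guth_maynard_holds.isBigO_of_le hε (by linarith) h₁ ?_
    show 15 / (3 + 5 * σ) ≤ 30 / (13 + 5 * d)
    rw [div_le_div_iff₀ (by linarith) hD]
    nlinarith

/-- **X1 from a gain in the third term (the crux `BeatThirtyThirteenths` modulo its one input).**
If for some `δ > 0` the `δ`-improved Guth–Maynard row
`LV(σ,τ) ≤ max(2−2σ, 18/5−4σ, τ+12/5−δ−4σ)` (`LargeValueBound`) holds for all
`69/100 ≤ σ ≤ 71/100` and `1 ≤ τ ≤ 3/2`, then there is `A < 30/13` with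
`N(σ,T) ≪_ε T^{A(1−σ)+ε}` for every `1/2 ≤ σ ≤ 1` — verbatim
`∃ A < 30/13, ZeroDensityEstimate (fun _ ↦ A) (1/2)`, the body of the DensityLadder crux X1; witness
`A = 30/(13 + 5·min(δ, 1/100))`. Guth–Maynard: "any further improvement would have to come from
the `S₃` term" — this theorem is the converse bookkeeping: an improvement there suffices.
[cite: GuthMaynard2026, Section 13.1, Remark after the proof of Theorem 1.2] [cite: TaoTrudgianYang2025, Corollary 43] -/
theorem exists_zeroDensityEstimate_lt_thirty_thirteenths_of_thirdTermGain {δ : ℝ} (hδ : 0 < δ)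
    (hLV : ∀ σ τ : ℝ, 69 / 100 ≤ σ → σ ≤ 71 / 100 → 1 ≤ τ → τ ≤ 3 / 2 →
      LargeValueBound σ τ (max (2 - 2 * σ) (max (18 / 5 - 4 * σ) (τ + 12 / 5 - δ - 4 * σ)))) :
    ∃ A : ℝ, A < 30 / 13 ∧ ZeroDensityEstimate (fun _ ↦ A) (1 / 2) := by
  have hd0 : 0 < min δ (1 / 100) := lt_min hδ (by norm_num)
  refine ⟨30 / (13 + 5 * min δ (1 / 100)), ?_,
    zeroDensityEstimate_of_thirdTermGain hd0 (min_le_right _ _) (min_le_left _ _) hLV⟩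
  rw [div_lt_div_iff₀ (by linarith) (by norm_num)]
  linarith

/-- The same from the row for ALL `σ` and all `τ > 0` (the shape of the tree theorem
`largeValueBound_guthMaynard`, with the gain `δ` in the third term). [cite: GuthMaynard2026, Theorem 1.1 and Section 13.1, Remark after the proof of Theorem 1.2] -/
theorem exists_zeroDensityEstimate_lt_thirty_thirteenths_of_thirdTermGain' {δ : ℝ} (hδ : 0 < δ)
    (hLV : ∀ σ τ : ℝ, 0 < τ →
      LargeValueBound σ τ (max (2 - 2 * σ) (max (18 / 5 - 4 * σ) (τ + 12 / 5 - δ - 4 * σ)))) :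
    ∃ A : ℝ, A < 30 / 13 ∧ ZeroDensityEstimate (fun _ ↦ A) (1 / 2) :=
  exists_zeroDensityEstimate_lt_thirty_thirteenths_of_thirdTermGain hδ
    fun σ τ _ _ hτ1 _ ↦ hLV σ τ (by linarith)

/-! ## From the finitary shape of Guth–Maynard's Theorem 1.1 with third term `T·N^{12/5−δ}·V⁻⁴` -/

/-- From a lower bound `N^x ≤ V` (`N > 0`) to `V⁻¹ ^ n ≤ N^{−xn}`; plumbing. [folklore] -/
private lemma inv_pow_le_rpow_neg' {N V x : ℝ} (hN : 0 < N) (hV : N ^ x ≤ V) (n : ℕ) :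
    V⁻¹ ^ n ≤ N ^ (-(x * n)) := by
  have hNx : 0 < N ^ x := Real.rpow_pos_of_pos hN x
  have hV0 : 0 < V := lt_of_lt_of_le hNx hV
  have h1 : V⁻¹ ≤ (N ^ x)⁻¹ := inv_anti₀ hNx hV
  calc V⁻¹ ^ n ≤ ((N ^ x)⁻¹) ^ n := pow_le_pow_left₀ (inv_nonneg.2 hV0.le) h1 n
    _ = N ^ (-(x * n)) := by
        rw [← Real.rpow_neg hN.le, ← Real.rpow_natCast, ← Real.rpow_mul hN.le]; ring_nf

/-- `T^{ε/(2(τ+1))} ≤ N^{ε/2}` when `0 < T ≤ N^{τ+δ}`, `N ≥ 1`, `0 ≤ δ ≤ 1`, `τ > 0`, `ε > 0`;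
plumbing. [folklore] -/
private lemma rpow_small_le' {N T τ δ ε : ℝ} (hN : 1 ≤ N) (hT0 : 0 < T) (hT : T ≤ N ^ (τ + δ))
    (hτ : 0 < τ) (hδ0 : 0 ≤ δ) (hδ1 : δ ≤ 1) (hε : 0 < ε) :
    T ^ (ε / (2 * (τ + 1))) ≤ N ^ (ε / 2) := by
  have hN0 : 0 < N := by linarith
  have h2 : (τ + δ) * (ε / (2 * (τ + 1))) ≤ ε / 2 := by
    have h3 : (τ + δ) / (τ + 1) ≤ 1 := by rw [div_le_one (by positivity)]; linarith
    calc (τ + δ) * (ε / (2 * (τ + 1))) = ε / 2 * ((τ + δ) / (τ + 1)) := by field_simp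
      _ ≤ ε / 2 * 1 := mul_le_mul_of_nonneg_left h3 (by positivity)
      _ = ε / 2 := mul_one _
  calc T ^ (ε / (2 * (τ + 1))) ≤ (N ^ (τ + δ)) ^ (ε / (2 * (τ + 1))) :=
        Real.rpow_le_rpow hT0.le hT (by positivity)
    _ = N ^ ((τ + δ) * (ε / (2 * (τ + 1)))) := by rw [← Real.rpow_mul hN0.le]
    _ ≤ N ^ (ε / 2) := Real.rpow_le_rpow_of_exponent_le hN h2

/-- **The `δ`-improved row from the finitary shape.** If for every `ε > 0` there is `C` with
`#W ≤ C T^ε (N²V⁻² + N^{18/5}V⁻⁴ + T N^{12/5−δ} V⁻⁴)` for all `T ≥ 1`, `N ≥ 1`, `1`-bounded `b`,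
`V > 0` and `1`-separated `W ⊂ [0,T]` carrying `|∑_{N ≤ n ≤ 2N} b_n n^{it}| ≥ V` (the tree's
`GuthMaynard2026_theorem_1_1` with `12/5` replaced by `12/5 − δ`), then
`LV(σ,τ) ≤ max(2−2σ, 18/5−4σ, τ+12/5−δ−4σ)` for every `σ` and every `τ > 0`. The bookkeeping of
`largeValueBound_guthMaynard` (`T ≤ N^{τ+δ'}`, `V ≥ N^{σ−δ'}`, `δ' = min(τ/2, 1/4, ε/10)`).
[cite: GuthMaynard2026, Theorem 1.1] [cite: TaoTrudgianYang2025, Definition 27 and the display (guth-maynard-lvt) before Theorem 32] -/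
theorem largeValueBound_of_thirdTermGain_finitary {δ : ℝ}
    (h : ∀ ε : ℝ, 0 < ε → ∃ C : ℝ, ∀ T : ℝ, 1 ≤ T →
      ∀ (N : ℕ) (b : ℕ → ℂ) (V : ℝ) (W : Finset ℝ), 1 ≤ N →
      (∀ n, ‖b n‖ ≤ 1) → 0 < V → (∀ t ∈ W, 0 ≤ t ∧ t ≤ T) →
      (∀ t ∈ W, ∀ t' ∈ W, t ≠ t' → 1 ≤ |t - t'|) →
      (∀ t ∈ W, V ≤ ‖∑ n ∈ Finset.Icc N (2 * N), b n * (n : ℂ) ^ ((t : ℂ) * I)‖) →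
      (W.card : ℝ) ≤ C * T ^ ε * ((N : ℝ) ^ 2 * V⁻¹ ^ 2 + (N : ℝ) ^ (18 / 5 : ℝ) * V⁻¹ ^ 4 +
        T * (N : ℝ) ^ (12 / 5 - δ) * V⁻¹ ^ 4))
    {σ τ : ℝ} (hτ : 0 < τ) :
    LargeValueBound σ τ (max (2 - 2 * σ) (max (18 / 5 - 4 * σ) (τ + 12 / 5 - δ - 4 * σ))) := by
  intro ε hε
  obtain ⟨M, hM⟩ : ∃ M : ℝ,
      max (2 - 2 * σ) (max (18 / 5 - 4 * σ) (τ + 12 / 5 - δ - 4 * σ)) = M := ⟨_, rfl⟩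
  have hM1 : 2 - 2 * σ ≤ M := by rw [← hM]; exact le_max_left _ _
  have hM2 : 18 / 5 - 4 * σ ≤ M := by rw [← hM]; exact (le_max_left _ _).trans (le_max_right _ _)
  have hM3 : τ + 12 / 5 - δ - 4 * σ ≤ M := by
    rw [← hM]; exact (le_max_right _ _).trans (le_max_right _ _)
  rw [hM]
  obtain ⟨C, hC⟩ := h (ε / (2 * (τ + 1))) (by positivity)
  obtain ⟨δ', hδ'⟩ : ∃ δ' : ℝ, min (τ / 2) (min (1 / 4) (ε / 10)) = δ' := ⟨_, rfl⟩
  have hδ0 : 0 < δ' := by rw [← hδ']; positivity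
  have hδτ : δ' ≤ τ / 2 := by rw [← hδ']; exact min_le_left _ _
  have hδ4 : δ' ≤ 1 / 4 := by rw [← hδ']; exact (min_le_right _ _).trans (min_le_left _ _)
  have hδε : δ' ≤ ε / 10 := by rw [← hδ']; exact (min_le_right _ _).trans (min_le_right _ _)
  refine ⟨max 16 (3 * max C 0), δ', hδ0, fun N T V a W hN hT₁ hT₂ hV₁ hV₂ ha hW hsep hla ↦ ?_⟩
  have hN16 : (16 : ℝ) ≤ N := (le_max_left _ _).trans hN
  have hN1 : (1 : ℝ) ≤ N := by linarith
  have hN0 : (0 : ℝ) < N := by linarith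
  have hNnat : 1 ≤ N := by exact_mod_cast hN1
  have hT1 : 1 ≤ T := (Real.one_le_rpow hN1 (by linarith)).trans hT₁
  have hT0 : 0 < T := by linarith
  have hV0 : 0 < V := lt_of_lt_of_le (Real.rpow_pos_of_pos hN0 _) hV₁
  have hR := hC T hT1 N a V W hNnat ha hV0 hW hsep hla
  have hC0 : 0 ≤ max C 0 := le_max_right _ _
  have hA : T ^ (ε / (2 * (τ + 1))) ≤ (N : ℝ) ^ (ε / 2) :=
    rpow_small_le' hN1 hT0 hT₂ hτ hδ0.le (by linarith) hε
  -- the three monomials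
  have i2 : V⁻¹ ^ 2 ≤ (N : ℝ) ^ (-((σ - δ') * (2 : ℕ))) := inv_pow_le_rpow_neg' hN0 hV₁ 2
  have i4 : V⁻¹ ^ 4 ≤ (N : ℝ) ^ (-((σ - δ') * (4 : ℕ))) := inv_pow_le_rpow_neg' hN0 hV₁ 4
  have t1 : (N : ℝ) ^ 2 * V⁻¹ ^ 2 ≤ (N : ℝ) ^ (M + ε / 2) := by
    calc (N : ℝ) ^ 2 * V⁻¹ ^ 2 ≤ (N : ℝ) ^ (2 : ℝ) * (N : ℝ) ^ (-((σ - δ') * (2 : ℕ))) := by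
          rw [← Real.rpow_two]; exact mul_le_mul_of_nonneg_left i2 (by positivity)
      _ = (N : ℝ) ^ (2 - 2 * σ + 2 * δ') := by rw [← Real.rpow_add hN0]; push_cast; ring_nf
      _ ≤ (N : ℝ) ^ (M + ε / 2) := Real.rpow_le_rpow_of_exponent_le hN1 (by linarith)
  have t2 : (N : ℝ) ^ (18 / 5 : ℝ) * V⁻¹ ^ 4 ≤ (N : ℝ) ^ (M + ε / 2) := by
    calc (N : ℝ) ^ (18 / 5 : ℝ) * V⁻¹ ^ 4
        ≤ (N : ℝ) ^ (18 / 5 : ℝ) * (N : ℝ) ^ (-((σ - δ') * (4 : ℕ))) :=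
          mul_le_mul_of_nonneg_left i4 (by positivity)
      _ = (N : ℝ) ^ (18 / 5 - 4 * σ + 4 * δ') := by rw [← Real.rpow_add hN0]; push_cast; ring_nf
      _ ≤ (N : ℝ) ^ (M + ε / 2) := Real.rpow_le_rpow_of_exponent_le hN1 (by linarith)
  have t3 : T * (N : ℝ) ^ (12 / 5 - δ) * V⁻¹ ^ 4 ≤ (N : ℝ) ^ (M + ε / 2) := by
    have h0 : 0 ≤ V⁻¹ ^ 4 := by positivity
    calc T * (N : ℝ) ^ (12 / 5 - δ) * V⁻¹ ^ 4
        ≤ (N : ℝ) ^ (τ + δ') * (N : ℝ) ^ (12 / 5 - δ) * (N : ℝ) ^ (-((σ - δ') * (4 : ℕ))) := by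
          gcongr
      _ = (N : ℝ) ^ (τ + δ' + (12 / 5 - δ) - 4 * σ + 4 * δ') := by
          rw [← Real.rpow_add hN0, ← Real.rpow_add hN0]; push_cast; ring_nf
      _ ≤ (N : ℝ) ^ (M + ε / 2) := Real.rpow_le_rpow_of_exponent_le hN1 (by linarith)
  have hsum : (N : ℝ) ^ 2 * V⁻¹ ^ 2 + (N : ℝ) ^ (18 / 5 : ℝ) * V⁻¹ ^ 4 +
      T * (N : ℝ) ^ (12 / 5 - δ) * V⁻¹ ^ 4 ≤ 3 * (N : ℝ) ^ (M + ε / 2) := by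
    have h := add_le_add (add_le_add t1 t2) t3
    linarith
  have hS0 : 0 ≤ (N : ℝ) ^ 2 * V⁻¹ ^ 2 + (N : ℝ) ^ (18 / 5 : ℝ) * V⁻¹ ^ 4 +
      T * (N : ℝ) ^ (12 / 5 - δ) * V⁻¹ ^ 4 := by positivity
  have hNε : 0 ≤ (N : ℝ) ^ (ε / 2) := by positivity
  have step1 : (W.card : ℝ) ≤ max C 0 * T ^ (ε / (2 * (τ + 1))) *
      ((N : ℝ) ^ 2 * V⁻¹ ^ 2 + (N : ℝ) ^ (18 / 5 : ℝ) * V⁻¹ ^ 4 +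
        T * (N : ℝ) ^ (12 / 5 - δ) * V⁻¹ ^ 4) :=
    hR.trans (mul_le_mul_of_nonneg_right
      (mul_le_mul_of_nonneg_right (le_max_left _ _) (by positivity)) hS0)
  have step2 : max C 0 * T ^ (ε / (2 * (τ + 1))) *
      ((N : ℝ) ^ 2 * V⁻¹ ^ 2 + (N : ℝ) ^ (18 / 5 : ℝ) * V⁻¹ ^ 4 +
        T * (N : ℝ) ^ (12 / 5 - δ) * V⁻¹ ^ 4) ≤
      max C 0 * (N : ℝ) ^ (ε / 2) * (3 * (N : ℝ) ^ (M + ε / 2)) :=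
    (mul_le_mul_of_nonneg_right (mul_le_mul_of_nonneg_left hA hC0) hS0).trans
      (mul_le_mul_of_nonneg_left hsum (mul_nonneg hC0 hNε))
  have step3 : max C 0 * (N : ℝ) ^ (ε / 2) * (3 * (N : ℝ) ^ (M + ε / 2)) =
      3 * max C 0 * (N : ℝ) ^ (M + ε) := by
    have : (N : ℝ) ^ (M + ε) = (N : ℝ) ^ (ε / 2) * (N : ℝ) ^ (M + ε / 2) := by
      rw [← Real.rpow_add hN0]; ring_nf
    rw [this]; ring
  have step4 : 3 * max C 0 * (N : ℝ) ^ (M + ε) ≤ max 16 (3 * max C 0) * (N : ℝ) ^ (M + ε) :=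
    mul_le_mul_of_nonneg_right (le_max_right _ _) (by positivity)
  linarith

/-- **X1 from the finitary `δ`-improved Theorem 1.1.** If for some `δ > 0` Guth–Maynard's Theorem
1.1 holds with third term `T·N^{12/5−δ}·V⁻⁴` (finitary shape of the tree's
`GuthMaynard2026_theorem_1_1`), then `∃ A < 30/13, ZeroDensityEstimate (fun _ ↦ A) (1/2)` — the
DensityLadder plan "`BeatThirtyThirteenths ⇐ LargeValuesThirdTermGain δ → S1 → BeatThirtyThirteenths`"
with everything after the first arrow kernel-checked. [cite: GuthMaynard2026, Theorem 1.1 and Section 13.1, Remark after the proof of Theorem 1.2] -/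
theorem exists_zeroDensityEstimate_lt_thirty_thirteenths_of_finitary {δ : ℝ} (hδ : 0 < δ)
    (h : ∀ ε : ℝ, 0 < ε → ∃ C : ℝ, ∀ T : ℝ, 1 ≤ T →
      ∀ (N : ℕ) (b : ℕ → ℂ) (V : ℝ) (W : Finset ℝ), 1 ≤ N →
      (∀ n, ‖b n‖ ≤ 1) → 0 < V → (∀ t ∈ W, 0 ≤ t ∧ t ≤ T) →
      (∀ t ∈ W, ∀ t' ∈ W, t ≠ t' → 1 ≤ |t - t'|) →
      (∀ t ∈ W, V ≤ ‖∑ n ∈ Finset.Icc N (2 * N), b n * (n : ℂ) ^ ((t : ℂ) * I)‖) →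
      (W.card : ℝ) ≤ C * T ^ ε * ((N : ℝ) ^ 2 * V⁻¹ ^ 2 + (N : ℝ) ^ (18 / 5 : ℝ) * V⁻¹ ^ 4 +
        T * (N : ℝ) ^ (12 / 5 - δ) * V⁻¹ ^ 4)) :
    ∃ A : ℝ, A < 30 / 13 ∧ ZeroDensityEstimate (fun _ ↦ A) (1 / 2) :=
  exists_zeroDensityEstimate_lt_thirty_thirteenths_of_thirdTermGain' hδ
    fun _ _ hτ ↦ largeValueBound_of_thirdTermGain_finitary h hτ

end Literature.NumberTheory.LFunctions

end
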